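import Summits.ResolutionOfSingularities.ResolutionOfSingularities.Theorems.PurelyInseparableDim4GameDeterminacy
import Summits.ResolutionOfSingularities.ResolutionOfSingularities.Theorems.PurelyInseparableDim4StepKitState
import HarnessLib
import HarnessLib.Audit.Tags

/-!
# Purely inseparable fourfolds — WIN CERTIFICATES for the full coordinate-centre game over a finite field
# [OURS · counted 0 · a certificate format for OUR frame, not about resolution]

Census cell «res-dim4-pi» (D-0157 DOOR 2), width seat `res-dim4-p-14`, brick PR-12t: the A-side twin of
the W3-13 trap certificates (`TrapCertSound`, `StepKitTrap`).  The trap census' other column — eng-w5's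
RUN 4b «A-WIN(k)» (player A beats every `𝔽₂`-RATIONAL answer of B within `k` moves; 1,102 / 1,105 roots
of the `D ≤ 4` band) — is the statement `StateWins q s` of `PurelyInseparableDim4GameDeterminacy` OVER
THE FINITE FIELD (`Edge` then ranges over the finitely many `K`-points `b`, `b_j = 0`).  This DEF-LIGHT
file gives it a kernel-checkable format over p-13's computable mirror `StepKit` (`SData`, `stepD`,
`permB`, `equiB`, `step_toState`, `isEquimultiplePoint_iff`, `isPermissibleCentre_iff`):

* `WCert K = List (SData 4 K × Finset (Fin 4))` — rows «(presented state, A's centre)», CHILDREN LATER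
  IN THE LIST (acyclicity for free);
* `winCertB q T` — every row is either TERMINAL (origin not `q`-fold: no permissible centre, A has won)
  or its centre is permissible and EVERY reply of B (`j ∈ S`, all `b : Fin 4 → K` with `b j = 0`,
  enumerated by `Fintype`) is not equimultiple, or kills `F`, or presents a state certified later;
* **`stateWins_of_winCertB`**: `winCertB q T = true → ∀ row ∈ T, StateWins q row.1.toState` (induction
  down the list with `Game.Wins.terminal` / `Game.Wins.move`);
* a two-row example `winCertB_example` (`F = x₁³`, `q = 2`, over `𝔽₂`: the divisor centre `{x₁}` wins at
  once) checked by `decide`.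

CAVEAT (PR-12k `EscapableInvariance.stateWins_of_stateWins_map`): ESCAPABLE descends but does NOT ascend
— a win over `𝔽₂` says nothing about `𝔽₄`-points of B.  Nothing here proves resolution of singularities
in dimension ≥ 4 / characteristic `p`; counted 0; AI work, weaker than expert review.
bears_on: LADDER-RESOLUTION:D157-DOOR2 (res-dim4-pi · PR-12t). Supports stmt-ResolutionOfSingularities-16155
(helper).
-/

set_option linter.dupNamespace false

noncomputable section

namespace Summit.ResolutionOfSingularities.ResolutionOfSingularities.Theorems.PIDim4

namespace WinCertSound

open Literature.AlgebraicGeometry.Resolution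
open StepKit

variable {K : Type} [Field K] [Fintype K] [DecidableEq K]

/-- A win-certificate row: a presented state and the coordinate centre player A blows up there.
[folklore] -/
abbrev WRow (K : Type) : Type := SData 4 K × Finset (Fin 4)

/-- A win certificate: a list of rows; the children of a row must occur LATER in the list. [folklore] -/
abbrev WCert (K : Type) : Type := List (WRow K)

/-- The child presented by `c` occurs (as a state) among the rows of `rest`. [folklore] -/
def childIn (rest : WCert K) (c : SData 4 K) : Bool :=
  rest.any fun r => c.equivB r.1

/-- B's reply `(j, b)` to the centre `S` at `s` is harmless: not an equimultiple point, or the cleaned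
transform vanishes, or the child is certified later. [folklore] -/
def replyOK (q : ℕ) (rest : WCert K) (s : SData 4 K) (S : Finset (Fin 4)) (j : Fin 4) (b : Fin 4 → K) :
    Bool :=
  !(equiB q S j b s) || StepKit.equivB (stepD q S j b s).L [] || childIn rest (stepD q S j b s)

/-- The row check: TERMINAL (origin not `q`-fold), or a permissible centre all of whose replies are
harmless. [folklore] -/
def rowOK (q : ℕ) (rest : WCert K) (row : WRow K) : Bool :=
  !(permB q Finset.univ row.1.L) ||
    (permB q row.2 row.1.L &&
      decide (∀ j ∈ row.2, ∀ b : Fin 4 → K, b j = 0 → replyOK q rest row.1 row.2 j b = true))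

/-- **The win-certificate checker.** [folklore] -/
def winCertB (q : ℕ) : WCert K → Bool
  | [] => true
  | row :: rest => rowOK q rest row && winCertB q rest

omit [Fintype K] in
/-- Soundness of `childIn`. [folklore] -/
theorem exists_of_childIn {rest : WCert K} {c : SData 4 K} (h : childIn rest c = true) :
    ∃ r ∈ rest, c.toState = r.1.toState := by
  unfold childIn at h
  obtain ⟨r, hr, hrc⟩ := List.any_eq_true.mp h
  exact ⟨r, hr, (toState_eq_iff c r.1).mpr hrc⟩

omit [Fintype K] in
/-- A state whose origin is not `q`-fold has no permissible centre. [folklore] -/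
theorem no_permissible_of_not_permB {q : ℕ} {s : SData 4 K} (h : permB q Finset.univ s.L = false) :
    ∀ S : Finset (Fin 4), ¬ IsPermissibleCentre q S s.toState.F := by
  intro S hS
  have huniv : IsPermissibleCentre q Finset.univ (evalT s.L) :=
    ⟨Finset.univ_nonempty, le_trans hS.2 (CentreBlowup.ordAlong_mono (Finset.subset_univ S) _)⟩
  have := (isPermissibleCentre_iff q Finset.univ s.L).mp huniv
  rw [h] at this
  exact Bool.false_ne_true this

/-- **SOUNDNESS of one row**: if every state of `rest` is escapable and `rowOK q rest row`, the row's
state is escapable. [folklore] -/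
theorem stateWins_of_rowOK {q : ℕ} {rest : WCert K} (hrest : ∀ r ∈ rest, StateWins q r.1.toState)
    {row : WRow K} (h : rowOK q rest row = true) : StateWins q row.1.toState := by
  unfold rowOK at h
  rw [Bool.or_eq_true] at h
  rcases h with hterm | hmove
  · -- terminal: no permissible centre
    have hperm : permB q Finset.univ row.1.L = false := by
      rw [Bool.not_eq_true'] at hterm; exact hterm
    exact Game.Wins.terminal (no_permissible_of_not_permB hperm)
  · rw [Bool.and_eq_true, decide_eq_true_eq] at hmove
    obtain ⟨hS, hall⟩ := hmove
    refine Game.Wins.move (m := row.2) ((isPermissibleCentre_iff q row.2 row.1.L).mpr hS) ?_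
    rintro s' ⟨j, b, hj, hbj, heq, hne, rfl⟩
    have h := hall j hj b hbj
    unfold replyOK at h
    rw [Bool.or_eq_true, Bool.or_eq_true] at h
    rcases h with (h1 | h2) | h3
    · -- not equimultiple: contradiction
      rw [Bool.not_eq_true', ← Bool.not_eq_true] at h1
      exact absurd ((isEquimultiplePoint_iff q row.2 j b row.1).mp heq) h1
    · -- zero child: contradiction
      exact absurd h2 (by rw [Bool.not_eq_true]; exact (step_F_ne_zero_iff q row.2 j b row.1).mp hne)
    · obtain ⟨r, hr, hrc⟩ := exists_of_childIn h3
      rw [step_toState, hrc]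
      exact hrest r hr

/-- **SOUNDNESS OF WIN CERTIFICATES**: every state of a checked certificate is ESCAPABLE
(`StateWins`: player A has a strategy beating every `K`-rational sequence of answers of B).
[folklore] -/
theorem stateWins_of_winCertB {q : ℕ} :
    ∀ {T : WCert K}, winCertB q T = true → ∀ row ∈ T, StateWins q row.1.toState
  | [], _ => fun row hrow => absurd hrow List.not_mem_nil
  | row :: rest, h => by
    unfold winCertB at h
    rw [Bool.and_eq_true] at h
    have hrest := stateWins_of_winCertB h.2
    intro r hr
    rcases List.mem_cons.mp hr with rfl | hr'
    · exact stateWins_of_rowOK hrest h.1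
    · exact hrest r hr'

/-- The ROOT (head row) of a checked certificate is escapable. [folklore] -/
theorem stateWins_head_of_winCertB {q : ℕ} {row : WRow K} {rest : WCert K}
    (h : winCertB q (row :: rest) = true) : StateWins q row.1.toState :=
  stateWins_of_winCertB h row List.mem_cons_self

/-! ## An example over `𝔽₂` -/

/-- The state `F = x₁³`, `r = 0`, `exc = ∅` over `𝔽₂`, with A's centre `{x₁}` (the divisor `x₁ = 0` lies
in the 2-fold locus). [folklore] -/
def exampleCert : WCert (ZMod 2) := [(⟨[(![3, 0, 0, 0], 1)], ![0, 0, 0, 0], ∅⟩, {0})]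

/-- The example certificate checks: after the blow-up of `V(z, x₁)` the transform `x₁` has order `1 < 2`
at every `𝔽₂`-point of the chart. [folklore] -/
theorem winCertB_example : winCertB 2 exampleCert = true := by
  decide

/-- Hence `x₁³` (as a `(4,1)` state over `𝔽₂`) is ESCAPABLE. [folklore] -/
theorem stateWins_example :
    StateWins 2 (⟨[(![3, 0, 0, 0], 1)], ![0, 0, 0, 0], ∅⟩ : SData 4 (ZMod 2)).toState :=
  stateWins_head_of_winCertB winCertB_example

end WinCertSound

end Summit.ResolutionOfSingularities.ResolutionOfSingularities.Theorems.PIDim4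

end
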